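import Summits.CriticalPhenomena.PercolationContinuityZ3.Theorems.PercNearOneGluingNoHeavyQuantFarBlockLaw
import HarnessLib

/-!
# QUANT lane R8, front "FAR beyond trees", layer one — PENDANT BLOCKS IV: a block carrying no relay can be re-weighted at will

builds on p205010 (kernel theorem, internal audit signed; external expert review pending)

Support file (`--supports stmt-CriticalPhenomena-4575`), seat `prim-quant-p1` (gen 19); memo
`run/shared/lean/prim/quant/prim-quant-p1-g19/FOR-LEAD-CACTI.md` §5.  Standard axioms; no sorries; no definitions.

If a block `Z` hangs at `c` under both `w` and `w'`, the two weight functions agree off `Z`, and NO relay lies in `Z`, then every relay marginal and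
the probability of `#{a ∈ A : o ↔ a} ≤ 1` are the same under `w` and `w'` (everything is read off the pairs avoiding `Z`); in particular the
`j = 1` FAR instance transfers (`Block.farLayerOne_unloaded`).  Used by the cactus theorem to dispose of relay-free pendant blocks.
[cite: Grimmett1999, §1.3 p. 10; §2.2]; the theorems [this work].
-/

noncomputable section

namespace Summit.CriticalPhenomena.PercolationContinuityZ3.Theorems

namespace Quant

namespace Block

open Finset MeasureTheory Set
open Literature.Probability.LatticeModels
open Literature.Probability.Percolation
open Bundle (offZ avoid real_offZ_event_eq_of_agree)
open scoped Classical

variable {n : ℕ} {o c : Fin n} {Z : Finset (Fin n)}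

/-- With no relay in the block, `P_w(#{a ∈ A : o ↔ a} ≤ 1)` is read off the pairs avoiding `Z`. [this work] -/
theorem real_card_le_one_eq_off (w : Sym2 (Fin n) → unitInterval) (ho : o ∉ Z)
    (hw : ∀ x y : Fin n, x ≠ y → x ∈ Z → y ∉ Z → y ≠ c → (w s(x, y) : ℝ) = 0) {A : Finset (Fin n)} (hA : ∀ a ∈ A, a ∉ Z) :
    (prodBernoulli w).real {ω : BondConfig (Fin n) | (A.filter fun a => ω ∈ openConn o a).card ≤ 1} =
      (prodBernoulli w).real {ω | (A.filter fun a => offZ Z ω ∈ openConn o a).card ≤ 1} := by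
  refine real_congr_of_good (c := c) (Z := Z) w hw _ _ fun ω hω => ?_
  simp only [mem_setOf_eq]
  have : (A.filter fun a => ω ∈ openConn o a) = (A.filter fun a => offZ Z ω ∈ openConn o a) :=
    Finset.filter_congr fun a ha => reach_off_iff hω ho (hA a ha)
  rw [this]

/-- **A relay-free pendant block may be re-weighted**: if `w` and `w'` agree off `Z`, both hang `Z` at `c`, `o ∉ Z` and `A ∩ Z = ∅`, then the
`j = 1` FAR instance at `(A, o, t)` for `w'` implies the one for `w`. [this work] -/
theorem farLayerOne_unloaded (w w' : Sym2 (Fin n) → unitInterval) (ho : o ∉ Z)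
    (hw : ∀ x y : Fin n, x ≠ y → x ∈ Z → y ∉ Z → y ≠ c → (w s(x, y) : ℝ) = 0)
    (hw' : ∀ x y : Fin n, x ≠ y → x ∈ Z → y ∉ Z → y ≠ c → (w' s(x, y) : ℝ) = 0)
    (hagree : ∀ e ∈ avoid Z, w e = w' e) (A : Finset (Fin n)) (hA : ∀ a ∈ A, a ∉ Z) (t : ℝ)
    (hfar' : (2 : ℝ) < ∑ a ∈ A, (prodBernoulli w').real (openConn o a) →
      (∀ a ∈ A, (prodBernoulli w').real (openConn o a)ᶜ ≤ t) →
      (prodBernoulli w').real {ω : BondConfig (Fin n) | (A.filter fun a => ω ∈ openConn o a).card ≤ 1} ≤ t)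
    (hsum : (2 : ℝ) < ∑ a ∈ A, (prodBernoulli w).real (openConn o a))
    (hcut : ∀ a ∈ A, (prodBernoulli w).real (openConn o a)ᶜ ≤ t) :
    (prodBernoulli w).real {ω : BondConfig (Fin n) | (A.filter fun a => ω ∈ openConn o a).card ≤ 1} ≤ t := by
  have hmeas : ∀ U : Set (BondConfig (Fin n)), MeasurableSet U := fun U => (Set.toFinite U).measurableSet
  have hmarg : ∀ a ∈ A, (prodBernoulli w').real (openConn o a) = (prodBernoulli w).real (openConn o a) := by
    intro a ha
    rw [real_openConn_off_eq (c := c) w' ho hw' (hA a ha), real_openConn_off_eq (c := c) w ho hw (hA a ha),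
      ← real_offZ_event_eq_of_agree w w' Z hagree (fun η => η ∈ openConn o a)]
  have hsum' : (2 : ℝ) < ∑ a ∈ A, (prodBernoulli w').real (openConn o a) := by rw [Finset.sum_congr rfl hmarg]; exact hsum
  have hcut' : ∀ a ∈ A, (prodBernoulli w').real (openConn o a)ᶜ ≤ t := by
    intro a ha
    rw [probReal_compl_eq_one_sub (hmeas _), hmarg a ha, ← probReal_compl_eq_one_sub (hmeas _)]
    exact hcut a ha
  have h := hfar' hsum' hcut'
  rw [real_card_le_one_eq_off w' ho hw' hA, ← real_offZ_event_eq_of_agree w w' Z hagree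
    (fun η => (A.filter fun a => η ∈ openConn o a).card ≤ 1)] at h
  rw [real_card_le_one_eq_off w ho hw hA]
  exact h

end Block

end Quant

end Summit.CriticalPhenomena.PercolationContinuityZ3.Theorems
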